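import Literature.Geometry.Lorentzian.KerrAxialSymmetryCovariant
import Literature.Geometry.Lorentzian.KerrAxialKillingField
import Literature.Geometry.Lorentzian.BoundedGeometry
import HarnessLib

/-!
# Twist maps of the Kerr–Schild chart: kinematics (crux `StarvedNecks.NeckGapDecay`,
# stmt-FinalStateConjecture-16768, line `Sketch`; model check of the physics stub's hypothesis)

A **twist** of the Kerr–Schild coordinate space by an angle field `β : E4 → ℝ` is the self-map
`K_β x = R_{β(x)} x`, where `R_α` is the axial rotation (`E4.axialRotation`, the flow of the axial Killing
field `∂_φ`).  When `β` is itself axially invariant, `K_β` is a smooth bijection with inverse `K_{−β}`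
preserving the time `x⁰`, the spatial radius and the Kerr–Schild radius.  Its differential is
`DK_β(x) v = R_{β(x)} (v + dβ(x)(v) · J x)` (`J` the rotation generator), so by the axial symmetry of the
Kerr metric the pulled-back Schwarzschild form is
`g(K x)(DK v, DK w) = g(x)(v + dβ(v) Jx, w + dβ(w) Jx)`, and since `ℓ(Jx) = 0` for `a = 0` the twist
DEVIATION `g(x)(v + dβ(v) Jx, w + dβ(w) Jx) − g(x)(v, w)` is the purely Minkowskian form
`dβ(v) η(Jx, w) + dβ(w) η(v, Jx) + dβ(v) dβ(w) η(Jx, Jx)`, of size `≤ 2‖dβ‖ s + (‖dβ‖ s)²`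
(`s = ‖x⃗‖`).  This is the algebra behind the twisted exact-Schwarzschild input of
`…Theorems.StarvedNecksNeckGapDecayTwistModel` (an HONEST input of the crux whose hole chart is NOT
self-certified, showing that the physics stub `GapCoreHolds` of the line `Sketch` is genuinely invoked).

References: O'Neill, *The geometry of Kerr black holes* (1995), Ch. 2, §2.2 (axial rotations);
Kerr–Schild 1965, §2; O'Neill 1983, Ch. 3 (pull-backs).  No Literature-level definitions: `twist`,
`twistDeriv`, `IsAxial` are Summit-side auxiliaries of this model check.
-/

noncomputable section

open Set Function Filter Topology
open scoped Topology ContDiff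

namespace Summit.FinalStateConjecture.FinalStateConjecture.Theorems.NeckGapDecay.ConnectionLevelCones.Twist

open Literature.Geometry.Lorentzian

-- the problem namespace `Summit.FinalStateConjecture.FinalStateConjecture` repeats the summit name by design
set_option linter.dupNamespace false

/-! ## The rotation generator commutes with the rotations; its size -/

/-- `J (R_α x) = R_α (J x)`: the generator commutes with its flow. [folklore] -/
theorem axialGenerator_axialRotation (α : ℝ) (x : E4) :
    E4.axialGenerator (E4.axialRotation α x) = E4.axialRotation α (E4.axialGenerator x) := by
  ext i
  fin_cases i <;> simp <;> ring

/-- `‖J x‖ ≤ ‖x⃗‖`: the generator has components `(0, −x₂, x₁, 0)`. [folklore] -/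
theorem norm_axialGenerator_le (x : E4) : ‖E4.axialGenerator x‖ ≤ E4.spatialNorm x := by
  have h1 : ‖E4.axialGenerator x‖ ^ 2 = x 1 ^ 2 + x 2 ^ 2 := by
    rw [EuclideanSpace.real_norm_sq_eq, Fin.sum_univ_four, E4.axialGenerator_apply_zero,
      E4.axialGenerator_apply_one, E4.axialGenerator_apply_two, E4.axialGenerator_apply_three]
    ring
  have h2 : E4.spatialNorm x ^ 2 = x 1 ^ 2 + x 2 ^ 2 + x 3 ^ 2 := E4.spatialNorm_sq x
  nlinarith [norm_nonneg (E4.axialGenerator x), E4.spatialNorm_nonneg x, sq_nonneg (x 3)]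

/-! ## Twist maps -/

/-- **The twist** of the Kerr–Schild coordinate space by the angle field `β`: `K_β x = R_{β(x)} x`.
O'Neill 1995, Ch. 2, §2.2. [folklore] -/
def twist (β : E4 → ℝ) (x : E4) : E4 := E4.axialRotation (β x) x

variable {β : E4 → ℝ}

/-- The twist preserves the time coordinate. [folklore] -/
@[simp] theorem twist_apply_zero (β : E4 → ℝ) (x : E4) : twist β x 0 = x 0 := by
  simp [twist]

/-- The twist preserves `x₃`. [folklore] -/
@[simp] theorem twist_apply_three (β : E4 → ℝ) (x : E4) : twist β x 3 = x 3 := by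
  simp [twist]

/-- The twist preserves the spatial radius. [folklore] -/
@[simp] theorem spatialNorm_twist (β : E4 → ℝ) (x : E4) : E4.spatialNorm (twist β x) = E4.spatialNorm x :=
  E4.spatialNorm_axialRotation _ _

/-- The twist preserves the Kerr–Schild radius. [folklore] -/
@[simp] theorem radius_twist (β : E4 → ℝ) (a : ℝ) (x : E4) : Kerr.radius a (twist β x) = Kerr.radius a x :=
  Kerr.radius_axialRotation _ _ _

/-- Where the angle vanishes the twist is the identity. [folklore] -/
theorem twist_eq_self (β : E4 → ℝ) {x : E4} (h : β x = 0) : twist β x = x := by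
  simp [twist, h]

/-- **Axially invariant angle fields**: `β (R_α x) = β x` for all `α`. [folklore] -/
def IsAxial (β : E4 → ℝ) : Prop := ∀ (α : ℝ) (x : E4), β (E4.axialRotation α x) = β x

/-- An axially invariant angle field takes the same value at a point and at its twist. [folklore] -/
theorem IsAxial.apply_twist (hβ : IsAxial β) (γ : E4 → ℝ) (x : E4) : β (twist γ x) = β x := hβ _ _

/-- `K_{−β} ∘ K_β = id` for an axially invariant angle field. [folklore] -/
theorem twist_neg_twist (hβ : IsAxial β) (x : E4) : twist (fun y ↦ -β y) (twist β x) = x := by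
  have h : β (twist β x) = β x := hβ.apply_twist β x
  show E4.axialRotation (-β (twist β x)) (twist β x) = x
  rw [h]
  exact E4.axialRotation_neg_axialRotation _ _

/-- `K_β ∘ K_{−β} = id` for an axially invariant angle field. [folklore] -/
theorem twist_twist_neg (hβ : IsAxial β) (x : E4) : twist β (twist (fun y ↦ -β y) x) = x := by
  have h : β (twist (fun y ↦ -β y) x) = β x := hβ.apply_twist _ x
  show E4.axialRotation (β (twist (fun y ↦ -β y) x)) (twist (fun y ↦ -β y) x) = x
  rw [h]
  exact E4.axialRotation_axialRotation_neg _ _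

/-- The twist by an axially invariant angle field is a bijection. [folklore] -/
theorem twist_bijective (hβ : IsAxial β) : Bijective (twist β) :=
  ⟨fun x y h ↦ by simpa [twist_neg_twist hβ] using congrArg (twist (fun y ↦ -β y)) h,
    fun y ↦ ⟨twist (fun y ↦ -β y) y, twist_twist_neg hβ y⟩⟩

/-- The twist by a continuous angle field is continuous. [folklore] -/
theorem continuous_twist (hc : Continuous β) : Continuous (twist β) := by
  have h : Continuous fun x : E4 ↦ (β x, x) := hc.prodMk continuous_id
  have h2 := E4.continuous_axialRotation_uncurry.comp h
  exact h2

/-- The twist by a `Cⁿ` angle field is `Cⁿ`. [folklore] -/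
theorem contDiff_twist {n : WithTop ℕ∞} (hc : ContDiff ℝ n β) : ContDiff ℝ n (twist β) := by
  have h : ContDiff ℝ n fun x : E4 ↦ (β x, x) := hc.prodMk contDiff_id
  have h2 := (E4.contDiff_axialRotation_uncurry (n := n)).comp h
  exact h2

/-- A negated axially invariant angle field is axially invariant. [folklore] -/
theorem IsAxial.neg (hβ : IsAxial β) : IsAxial (fun y ↦ -β y) := fun α x ↦ by
  simp [hβ α x]

/-- **The twist as a homeomorphism** of `E4` (axially invariant continuous angle field). [folklore] -/
def twistHomeomorph (hβ : IsAxial β) (hc : Continuous β) : E4 ≃ₜ E4 where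
  toFun := twist β
  invFun := twist (fun y ↦ -β y)
  left_inv := twist_neg_twist hβ
  right_inv := twist_twist_neg hβ
  continuous_toFun := continuous_twist hc
  continuous_invFun := continuous_twist hc.neg

/-- The homeomorphism is the twist. [folklore] -/
@[simp] theorem twistHomeomorph_apply (hβ : IsAxial β) (hc : Continuous β) (x : E4) :
    twistHomeomorph hβ hc x = twist β x := rfl

/-! ## The differential of a twist -/

/-- **The differential of the twist**: `DK_β(x) = R_{β(x)} ∘ (id + dβ(x) ⊗ J x)`. [folklore] -/
def twistDeriv (β : E4 → ℝ) (β' : E4 →L[ℝ] ℝ) (x : E4) : E4 →L[ℝ] E4 :=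
  (E4.axialRotation (β x)).comp (ContinuousLinearMap.id ℝ E4 + β'.smulRight (E4.axialGenerator x))

/-- `DK_β(x) v = R_{β(x)} (v + dβ(x)(v) · J x)`. [folklore] -/
theorem twistDeriv_apply (β : E4 → ℝ) (β' : E4 →L[ℝ] ℝ) (x v : E4) :
    twistDeriv β β' x v = E4.axialRotation (β x) (v + β' v • E4.axialGenerator x) := by
  simp [twistDeriv]

/-- **Chain rule for the twist**: if `dβ(x) = β'` then `dK_β(x) = twistDeriv β β' x`.  Componentwise:
`K¹ = cos β · x₁ − sin β · x₂`, `K² = sin β · x₁ + cos β · x₂`, `K⁰ = x⁰`, `K³ = x³`. [folklore] -/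
theorem hasFDerivAt_twist {x : E4} {β' : E4 →L[ℝ] ℝ} (hβ : HasFDerivAt β β' x) :
    HasFDerivAt (twist β) (twistDeriv β β' x) x := by
  have hp : ∀ j : Fin 4, HasFDerivAt (fun y : E4 ↦ y j) (PiLp.proj (𝕜 := ℝ) 2 (fun _ : Fin 4 ↦ ℝ) j) x := fun j ↦
    (PiLp.proj (𝕜 := ℝ) 2 (fun _ : Fin 4 ↦ ℝ) j).hasFDerivAt
  have hcos : HasFDerivAt (fun y ↦ Real.cos (β y)) ((-Real.sin (β x)) • β') x := hβ.cos
  have hsin : HasFDerivAt (fun y ↦ Real.sin (β y)) (Real.cos (β x) • β') x := hβ.sin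
  rw [show twist β = fun y ↦ E4.axialRotation (β y) y from rfl]
  refine (hasFDerivWithinAt_univ.mp ∘ fun h ↦ h) ?_
  rw [hasFDerivWithinAt_euclidean]
  intro i
  rw [hasFDerivWithinAt_univ]
  fin_cases i
  · -- time component
    have h := hp 0
    refine (h.congr_fderiv ?_).congr_of_eventuallyEq (Eventually.of_forall fun y ↦ ?_)
    · ext v
      simp [twistDeriv_apply]
    · simp
  · -- first rotated component
    have h : HasFDerivAt (fun y : E4 ↦ Real.cos (β y) * y 1 - Real.sin (β y) * y 2)
        (Real.cos (β x) • PiLp.proj (𝕜 := ℝ) 2 (fun _ : Fin 4 ↦ ℝ) 1 + x 1 • ((-Real.sin (β x)) • β') -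
          (Real.sin (β x) • PiLp.proj (𝕜 := ℝ) 2 (fun _ : Fin 4 ↦ ℝ) 2 + x 2 • (Real.cos (β x) • β'))) x :=
      (hcos.mul (hp 1)).sub (hsin.mul (hp 2))
    refine (h.congr_fderiv ?_).congr_of_eventuallyEq (Eventually.of_forall fun y ↦ ?_)
    · ext v
      simp [twistDeriv_apply]
      ring
    · simp
  · -- second rotated component
    have h : HasFDerivAt (fun y : E4 ↦ Real.sin (β y) * y 1 + Real.cos (β y) * y 2)
        (Real.sin (β x) • PiLp.proj (𝕜 := ℝ) 2 (fun _ : Fin 4 ↦ ℝ) 1 + x 1 • (Real.cos (β x) • β') +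
          (Real.cos (β x) • PiLp.proj (𝕜 := ℝ) 2 (fun _ : Fin 4 ↦ ℝ) 2 + x 2 • ((-Real.sin (β x)) • β'))) x :=
      (hsin.mul (hp 1)).add (hcos.mul (hp 2))
    refine (h.congr_fderiv ?_).congr_of_eventuallyEq (Eventually.of_forall fun y ↦ ?_)
    · ext v
      simp [twistDeriv_apply]
      ring
    · simp
  · -- `x₃`
    have h := hp 3
    refine (h.congr_fderiv ?_).congr_of_eventuallyEq (Eventually.of_forall fun y ↦ ?_)
    · ext v
      simp [twistDeriv_apply]
    · simp

/-! ## The twist deviation of the Schwarzschild form -/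

/-- **Pull-back of the Kerr form under the twist differential** (axial symmetry):
`g(K x)(DK v, DK w) = g(x)(v + dβ(v) Jx, w + dβ(w) Jx)`. Kerr–Schild 1965, §2; O'Neill 1995, Ch. 2, §2.2.
[folklore] -/
theorem kerr_bilin_twist (M a : ℝ) (β : E4 → ℝ) (β' : E4 →L[ℝ] ℝ) (x v w : E4) :
    Kerr.bilin M a (twist β x) (twistDeriv β β' x v) (twistDeriv β β' x w) =
      Kerr.bilin M a x (v + β' v • E4.axialGenerator x) (w + β' w • E4.axialGenerator x) := by
  rw [twistDeriv_apply, twistDeriv_apply, twist, Kerr.bilin_axialRotation]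

/-- For `a = 0` the Kerr–Schild null covector kills the rotation generator: `ℓ(x)(J x) = 0`
(`ℓ = (1, x⃗/r)` and `x⃗ · J x⃗ = 0`). Kerr–Schild 1965, §2. [folklore] -/
theorem nullCovector_zero_axialGenerator (x : E4) : Kerr.nullCovector 0 x (E4.axialGenerator x) = 0 := by
  simp only [Kerr.nullCovector, Kerr.nullCovectorFun, E4.covector_apply, Fin.sum_univ_four,
    E4.axialGenerator_apply_zero, E4.axialGenerator_apply_one, E4.axialGenerator_apply_two,
    E4.axialGenerator_apply_three, Matrix.cons_val_zero, Matrix.cons_val_one, Matrix.cons_val]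
  ring

/-- **The twist deviation of the Schwarzschild form is Minkowskian**:
`g(x)(v + a Jx, w + b Jx) − g(x)(v, w) = a η(Jx, w) + b η(v, Jx) + a b η(Jx, Jx)` (`ℓ(Jx) = 0`).
[folklore] -/
theorem kerr_bilin_add_smul_sub (M : ℝ) (x v w : E4) (a b : ℝ) :
    Kerr.bilin M 0 x (v + a • E4.axialGenerator x) (w + b • E4.axialGenerator x) - Kerr.bilin M 0 x v w =
      a * Minkowski.bilin (E4.axialGenerator x) w + b * Minkowski.bilin v (E4.axialGenerator x) +
        a * b * Minkowski.bilin (E4.axialGenerator x) (E4.axialGenerator x) := by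
  have hJ := nullCovector_zero_axialGenerator x
  simp only [Kerr.bilin_apply, map_add, map_smul, add_apply, smul_apply, smul_eq_mul, hJ]
  ring

/-- **Size of the twist deviation**: with `a = dβ(v)`, `b = dβ(w)`,
`|a η(Jx, w) + b η(v, Jx) + a b η(Jx, Jx)| ≤ (2 ‖dβ‖ s + (‖dβ‖ s)²) ‖v‖ ‖w‖`, `s = ‖x⃗‖`
(`|η(p, q)| ≤ ‖p‖ ‖q‖`, `‖Jx‖ ≤ s`). [folklore] -/
theorem abs_twistForm_le (β' : E4 →L[ℝ] ℝ) (x v w : E4) :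
    |β' v * Minkowski.bilin (E4.axialGenerator x) w + β' w * Minkowski.bilin v (E4.axialGenerator x) +
        β' v * β' w * Minkowski.bilin (E4.axialGenerator x) (E4.axialGenerator x)| ≤
      (2 * (‖β'‖ * E4.spatialNorm x) + (‖β'‖ * E4.spatialNorm x) ^ 2) * (‖v‖ * ‖w‖) := by
  set J := E4.axialGenerator x with hJdef
  set s := E4.spatialNorm x with hs
  have hJs : ‖J‖ ≤ s := norm_axialGenerator_le x
  have hs0 : 0 ≤ s := E4.spatialNorm_nonneg x
  have hn0 : 0 ≤ ‖β'‖ := norm_nonneg _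
  have hv0 : 0 ≤ ‖v‖ := norm_nonneg _
  have hw0 : 0 ≤ ‖w‖ := norm_nonneg _
  have hav : |β' v| ≤ ‖β'‖ * ‖v‖ := by
    have := β'.le_opNorm v; rwa [Real.norm_eq_abs] at this
  have haw : |β' w| ≤ ‖β'‖ * ‖w‖ := by
    have := β'.le_opNorm w; rwa [Real.norm_eq_abs] at this
  have h1 : |Minkowski.bilin J w| ≤ s * ‖w‖ :=
    (Minkowski.abs_bilin_le J w).trans (mul_le_mul_of_nonneg_right hJs hw0)
  have h2 : |Minkowski.bilin v J| ≤ ‖v‖ * s :=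
    (Minkowski.abs_bilin_le v J).trans (mul_le_mul_of_nonneg_left hJs hv0)
  have h3 : |Minkowski.bilin J J| ≤ s * s :=
    (Minkowski.abs_bilin_le J J).trans (mul_le_mul hJs hJs (norm_nonneg _) hs0)
  have t1 : |β' v * Minkowski.bilin J w| ≤ ‖β'‖ * s * (‖v‖ * ‖w‖) := by
    rw [abs_mul]
    calc |β' v| * |Minkowski.bilin J w| ≤ (‖β'‖ * ‖v‖) * (s * ‖w‖) :=
          mul_le_mul hav h1 (abs_nonneg _) (by positivity)
      _ = ‖β'‖ * s * (‖v‖ * ‖w‖) := by ring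
  have t2 : |β' w * Minkowski.bilin v J| ≤ ‖β'‖ * s * (‖v‖ * ‖w‖) := by
    rw [abs_mul]
    calc |β' w| * |Minkowski.bilin v J| ≤ (‖β'‖ * ‖w‖) * (‖v‖ * s) :=
          mul_le_mul haw h2 (abs_nonneg _) (by positivity)
      _ = ‖β'‖ * s * (‖v‖ * ‖w‖) := by ring
  have t3 : |β' v * β' w * Minkowski.bilin J J| ≤ (‖β'‖ * s) ^ 2 * (‖v‖ * ‖w‖) := by
    rw [abs_mul, abs_mul]
    calc |β' v| * |β' w| * |Minkowski.bilin J J| ≤ (‖β'‖ * ‖v‖) * (‖β'‖ * ‖w‖) * (s * s) :=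
          mul_le_mul (mul_le_mul hav haw (abs_nonneg _) (by positivity)) h3 (abs_nonneg _) (by positivity)
      _ = (‖β'‖ * s) ^ 2 * (‖v‖ * ‖w‖) := by ring
  calc _ ≤ |β' v * Minkowski.bilin J w| + |β' w * Minkowski.bilin v J| + |β' v * β' w * Minkowski.bilin J J| :=
        (abs_add_le _ _).trans (add_le_add (abs_add_le _ _) le_rfl)
    _ ≤ ‖β'‖ * s * (‖v‖ * ‖w‖) + ‖β'‖ * s * (‖v‖ * ‖w‖) + (‖β'‖ * s) ^ 2 * (‖v‖ * ‖w‖) :=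
        add_le_add (add_le_add t1 t2) t3
    _ = (2 * (‖β'‖ * s) + (‖β'‖ * s) ^ 2) * (‖v‖ * ‖w‖) := by ring

end Summit.FinalStateConjecture.FinalStateConjecture.Theorems.NeckGapDecay.ConnectionLevelCones.Twist

end
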